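/-
COR-CM (cells pub-hodgecm / pub-hodgecm2, Hodge ladder stage 2) — TRANSPOSITION item (vi), sub-binder S2 `supply`
(hodge-director/ITEM6-SPLIT.md §(c′) (vi-2) / §5): the SHIMURA–ALBANESE side (C0/C6a) of the object match, SURJECTIVE form —
a surjective homomorphism of complex abelian varieties kills no non-zero homomorphism (faithfulness of `H¹` + Voisin's
injectivity of `f^*` for surjective `f`), so the tower-product hypothesis of `CorCM/AlbaneseSideReachTransfer.lean` (binder-2,
p287196) may be taken in the shape the printed sources deliver it: a SURJECTION `∏_j Alb P_{Γ_j}(V) ↠ A`.  Written by the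
stage-1 binder seat pub-hodgecm-mc-binder-2 (gen 22, prover-pub-hodgecm-mc-binder-2-g22-0) in its own count-neutral lane
(theorems only: no definition, no instance, no named fact, nothing asserted; nothing under `CorCM/B01/` or
`CorCM/B01/Transposition/` is edited or restated; independent of p287196 — imports binder-1's p283674 only).  HC_CM is NOT proved.
-/
import Summits.HodgeConjecture.CorCM.CMSideReachOfInverseType
import Literature.AlgebraicGeometry.Motives.AlbaneseHomNonvanishing
import HarnessLib

/-!
# The Albanese side of the S2 object match, surjective form

For homomorphisms of complex abelian varieties `p : P ⟶ A`, `φ : A ⟶ B`: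

* §1 `AlbReach.comp_ne_zero_of_surjective` — if `p` is SURJECTIVE (on schemes) and `φ ≠ 0` then `p ≫ φ ≠ 0`: `p^*` is injective
  on `H¹(−(ℂ); ℂ)` (Voisin I Lemma 7.28, tree theorem `complexBetti_map_injective_of_surjective`) and the representation of
  `Hom(A, B)` on `H¹` is faithful (Birkenhake–Lange §1.1, tree theorem `hom_eq_zero_of_complexBetti_map_one_eq_zero`), while
  `(p ≫ φ)^* = φ^* ≫ p^*`; hence `AlbReach.epi_of_surjective` — a surjective homomorphism is an EPIMORPHISM of `AbelianVariety ℂ`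
  (preadditive: test on `g - h`) — and `exists_hom_ne_zero_of_surjective`, `exists_factor_hom_ne_zero_of_surjective` (out of a
  finite product fan `∏_j X_j ↠ A`, binder-1's `CMReach.exists_inj_comp_ne_zero`).
* §2 (universe of record) `Model.exists_level_hom_ne_zero_of_surjective` / `_of_tmul_of_surjective`: for finitely many levels
  `Γ_j : Level V` of one `V`-tower with Albanese data `𝒥_j`, a product fan `(P, π_j : P ⟶ (𝒥 j).J)` and a SURJECTIVE `p : P ⟶ A`,
  every non-zero `φ : A ⟶ B` (or non-zero `x ∈ ℚ ⊗ Hom(A, B)`) yields `∃ (Γ : Level V) (𝒥 : Jacobian (P_Γ(V))) (w : 𝒥.J ⟶ B), w ≠ 0`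
  — the consequent of own-htheta's `hReach` (`Transposition/Item6SupplyPinned.lean`) verbatim.
* §3 SCHEMA `Model.reach_of_albanesePin_surjective`: the `hReach` clause at a second pin `AK K` (intended `A_K ⊗_{E,ι₁} ℂ`) from
  (U1) a Hom carrier into `ℚ ⊗ Hom(AK K, Aμ D)` and (U3ˢ) on good `K` a finite product fan of tower Albanese varieties with a
  SURJECTIVE homomorphism onto `AK K` — the shape in which [Liu2021] App. C (l. 4575–4599, Prop. C.5: `X_{K'} ⊗_{E,ι₁} ℂ =
  ⊔_g Γ_g\𝔹²` at a neat `K' ≤ K`) + «Albanese of a finite disjoint union := product» + «the Albanese map of a dominant morphism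
  is surjective» (for `u^{K'}_K`) deliver it, with no `[deg]`-splitting / isogeny bookkeeping.  Uniform in `[F:ℚ]` and in the
  face; nothing automorphic, nothing of B01-S discharged; (U1), (U3ˢ) are not inhabited here.  HC_CM is NOT proved.

References: C. Voisin, *Hodge Theory and Complex Algebraic Geometry I* (2002) Lemma 7.28; C. Birkenhake, H. Lange, *Complex
Abelian Varieties* (1992/2004) §1.1–1.2 (the analytic and rational representations are injective); D. Mumford, *Abelian
Varieties* (1970) §19 Thm. 1 Cor. 1; Y. Liu, Camb. J. Math. 9 (2021) §4.2, Thm. 4.18 (1), App. C.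
-/

noncomputable section

open CategoryTheory CategoryTheory.Limits AlgebraicGeometry
open Literature.AlgebraicGeometry.Motives
open Literature.AlgebraicGeometry.HodgeTheory
open Literature.NumberTheory.Automorphic.PicardCM

namespace Summit.HodgeConjecture.CorCM

namespace AlbReach

/-! ## §1 Surjective homomorphisms kill no non-zero homomorphism -/

section Surjective

variable {P A B : AbelianVariety ℂ}

/-- **A surjective homomorphism kills no non-zero homomorphism**: for homomorphisms of complex abelian varieties `p : P ⟶ A`
SURJECTIVE and `φ : A ⟶ B` non-zero, `p ≫ φ ≠ 0` — `(p ≫ φ)^* = φ^* ≫ p^*` on `H¹(−(ℂ); ℂ)`, `p^*` is injective (Voisin I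
Lemma 7.28, tree theorem `complexBetti_map_injective_of_surjective`) and `φ ↦ φ^*|_{H¹}` is faithful (tree theorem
`hom_eq_zero_of_complexBetti_map_one_eq_zero`). [cite: Voisin2002, Lemma 7.28] [cite: LangeBirkenhake1992, §1.1 (ρ_r injective)] -/
theorem comp_ne_zero_of_surjective (p : P ⟶ A) [Surjective (AbelianVariety.Hom.toSchemeHom p)] {φ : A ⟶ B}
    (hφ : φ ≠ 0) : p ≫ φ ≠ 0 := by
  intro h0
  apply hφ
  apply Literature.AlgebraicGeometry.ComplexMultiplication.hom_eq_zero_of_complexBetti_map_one_eq_zero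
  have hinj : Function.Injective (complexBetti.map p.hom.hom.hom 1) :=
    complexBetti_map_injective_of_surjective (AbelianVariety.isSmoothProjective_holds (A := A))
      (AbelianVariety.isSmoothProjective_holds (A := P)) p.hom.hom.hom 1
  have hcomp : (complexBetti.map p.hom.hom.hom 1).hom.comp (complexBetti.map φ.hom.hom.hom 1).hom = 0 := by
    rw [← ModuleCat.hom_comp, ← complexBetti_map_comp_hom, h0, complexBetti_map_zero_one, ModuleCat.hom_zero]
  refine LinearMap.ext fun v => hinj ?_
  change (complexBetti.map p.hom.hom.hom 1).hom ((complexBetti.map φ.hom.hom.hom 1).hom v) =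
    (complexBetti.map p.hom.hom.hom 1).hom ((0 : _ →ₗ[ℂ] _) v)
  rw [← LinearMap.comp_apply, hcomp, LinearMap.zero_apply, LinearMap.zero_apply, map_zero]

/-- **A surjective homomorphism of complex abelian varieties is an epimorphism** of `AbelianVariety ℂ` (`p ≫ g = p ≫ h ⇒
p ≫ (g - h) = 0 ⇒ g - h = 0`). [cite: Voisin2002, Lemma 7.28] [cite: LangeBirkenhake1992, §1.1 (ρ_r injective)] -/
theorem epi_of_surjective (p : P ⟶ A) [Surjective (AbelianVariety.Hom.toSchemeHom p)] : Epi p :=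
  ⟨fun g h hgh => sub_eq_zero.1 <| by_contra fun hne =>
    comp_ne_zero_of_surjective p hne (by rw [Preadditive.comp_sub, hgh, sub_self])⟩

/-- **Surjections pass non-zero homomorphisms up**: `Hom(A, B) ∋ φ ≠ 0 ⇒ Hom(P, B) ∋ p ≫ φ ≠ 0` for a surjective `p : P ⟶ A`.
[cite: Voisin2002, Lemma 7.28] -/
theorem exists_hom_ne_zero_of_surjective (p : P ⟶ A) [Surjective (AbelianVariety.Hom.toSchemeHom p)] {φ : A ⟶ B}
    (hφ : φ ≠ 0) : ∃ v : P ⟶ B, v ≠ 0 :=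
  ⟨p ≫ φ, comp_ne_zero_of_surjective p hφ⟩

variable {J : Type} [Fintype J] [DecidableEq J] {X : J → AbelianVariety ℂ} {π : (j : J) → (P ⟶ X j)}

/-- **Out of a finite product, through a SURJECTION `∏_j X_j ↠ A`**: every non-zero `φ : A ⟶ B` yields a factor `j` and a
non-zero `X j ⟶ B` (binder-1's `CMReach.exists_inj_comp_ne_zero` after `comp_ne_zero_of_surjective`).
[cite: MumfordAV1970, §19 Thm. 1 Cor. 1 (p. 173)] [cite: Voisin2002, Lemma 7.28] -/
theorem exists_factor_hom_ne_zero_of_surjective (hlim : IsLimit (Fan.mk P π)) (p : P ⟶ A)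
    [Surjective (AbelianVariety.Hom.toSchemeHom p)] {φ : A ⟶ B} (hφ : φ ≠ 0) :
    ∃ (j : J) (v : X j ⟶ B), v ≠ 0 := by
  obtain ⟨j, s, -, hs⟩ := CMReach.exists_inj_comp_ne_zero hlim (comp_ne_zero_of_surjective p hφ)
  exact ⟨j, s ≫ p ≫ φ, hs⟩

end Surjective

end AlbReach

/-! ## §2 The universe of record: a SURJECTION from a finite product of tower Albanese varieties delivers the consequent of `hReach` -/

namespace Model

open AlbReach

section Tower

variable (h₁ : BallQuotientUniformised) (h₃ : CMAbelianVarietyRealised)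
  {F : CMField} {ι₁ : F →+* ℂ} {V : HermSpace3 F ι₁}
  {J : Type} [Fintype J] [DecidableEq J] (Γ : J → Level V)
  (𝒥 : ∀ j : J, Jacobian (Var.scheme (ballQuotientUniformisedDatum_of h₁) h₃ (.pms (pmsCode F ι₁ V (Γ j)))))
  {P A B : AbelianVariety ℂ} {π : (j : J) → (P ⟶ (𝒥 j).J)}

/-- **A finite product of tower Albanese varieties SURJECTING onto `A` reaches, on some level, whatever `A` maps to non-trivially**
(`U = picardCMUniverse hHD hI h₁ h₃`; intended `P = ∏_g Alb(Γ_g\𝔹²) = Alb(X_{K'} ⊗_{E,ι₁} ℂ)` at a neat `K' ≤ K`, `A = A_K ⊗_{E,ι₁} ℂ`,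
`p = Alb(u^{K'}_K)` surjective, [Liu2021] §4.2 + App. C Prop. C.5): every non-zero `φ : A ⟶ B` gives a level `Γ`, an Albanese
datum `𝒥` of `P_Γ(V)` and a non-zero `𝒥.J ⟶ B` — the consequent of own-htheta's `hReach` verbatim.
[cite: Liu2021, §4.2 and App. C Prop. C.5] [cite: Voisin2002, Lemma 7.28] -/
theorem exists_level_hom_ne_zero_of_surjective (hlim : IsLimit (Fan.mk P π)) (p : P ⟶ A)
    [Surjective (AbelianVariety.Hom.toSchemeHom p)] {φ : A ⟶ B} (hφ : φ ≠ 0) :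
    ∃ (Γ₀ : Level V) (𝒥₀ : Jacobian (Var.scheme (ballQuotientUniformisedDatum_of h₁) h₃ (.pms (pmsCode F ι₁ V Γ₀))))
      (u : 𝒥₀.J ⟶ B), u ≠ 0 := by
  obtain ⟨j, v, hv⟩ := exists_factor_hom_ne_zero_of_surjective hlim p hφ
  exact ⟨Γ j, 𝒥 j, v, hv⟩

/-- **… with the datum read in `ℚ ⊗ Hom(A, B)`** (Liu's `Hom_E(A_K, A_μ)_ℚ` after base change to `ℂ`; binder-1's
`Model.exists_ne_zero_of_tmul_ne_zero`). [cite: Liu2021, §4.2, Thm. 4.18 (1) and App. C Prop. C.5] -/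
theorem exists_level_hom_ne_zero_of_tmul_of_surjective (hlim : IsLimit (Fan.mk P π)) (p : P ⟶ A)
    [Surjective (AbelianVariety.Hom.toSchemeHom p)] {x : TensorProduct ℤ ℚ (A ⟶ B)} (hx : x ≠ 0) :
    ∃ (Γ₀ : Level V) (𝒥₀ : Jacobian (Var.scheme (ballQuotientUniformisedDatum_of h₁) h₃ (.pms (pmsCode F ι₁ V Γ₀))))
      (u : 𝒥₀.J ⟶ B), u ≠ 0 := by
  obtain ⟨φ, hφ⟩ := exists_ne_zero_of_tmul_ne_zero hx
  exact exists_level_hom_ne_zero_of_surjective h₁ h₃ Γ 𝒥 hlim p hφ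

end Tower

/-! ## §3 SCHEMA, surjective form: `hReach` at a doubly pinned datum from (U1) a Hom carrier + (U3ˢ) a tower-product SURJECTING onto `A_K ⊗ ℂ` -/

section Schema

variable (h₁ : BallQuotientUniformised) (h₃ : CMAbelianVarietyRealised)
  {F : CMField} {ι₁ : F →+* ℂ} {V : HermSpace3 F ι₁}

/-- **SCHEMA for `hReach` at a second pin, surjective form** (`U = picardCMUniverse hHD hI h₁ h₃`; one face context `(F, ι₁, V)`
and one CM type at a time; outer guards are the caller's).  Abstract carriers `Lvl` (intended `Subgroup G`), `good` (intended
`IsOpenCompact`), `Obj` (intended `𝒜(μ)`), `Hom K D` with a zero (intended `Hom_E(A_K, A_μ)_ℚ`); pins `AK K`, `Aμ D :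
AbelianVariety ℂ` (intended `A_K ⊗_{E,ι₁} ℂ`, `A_μ ⊗_{E,ι₁} ℂ`).  Hypotheses = the two object identifications that stay POSITED:
(U1) `hcar` — on good `K` a non-zero `φ ∈ Hom K D` has non-zero image in `ℚ ⊗ Hom(AK K, Aμ D)` [Liu2021 §4.2, Thm. 4.18 (1)];
(U3ˢ) `hAlb` — on good `K`, finitely many `Γ_j : Level V` with Albanese data, a product fan of the `Alb P_{Γ_j}(V)`, and a
SURJECTIVE homomorphism from the product onto `AK K` [Liu2021 App. C l. 4575–4599 + Prop. C.5 at a neat `K' ≤ K`; Albanese of a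
disjoint union; Albanese of a dominant morphism is surjective].  Conclusion = own-htheta's `hReach` clause at `(F, ι₁, V, Φ)`.
Uniform in `[F:ℚ]` and in the face.  HC_CM is NOT proved; (U1), (U3ˢ) are not inhabited here.
[cite: Liu2021, §4.2, Thm. 4.18 (1) and App. C Prop. C.5] [cite: Voisin2002, Lemma 7.28] -/
theorem reach_of_albanesePin_surjective {Lvl Obj : Type} (good : Lvl → Prop) (Hom : Lvl → Obj → Type)
    [∀ K D, Zero (Hom K D)] (AK : Lvl → AbelianVariety ℂ) (Aμ : Obj → AbelianVariety ℂ)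
    (carrier : ∀ (K : Lvl) (D : Obj), Hom K D → TensorProduct ℤ ℚ (AK K ⟶ Aμ D))
    (hcar : ∀ (K : Lvl) (D : Obj) (φ : Hom K D), good K → φ ≠ 0 → carrier K D φ ≠ 0)
    (hAlb : ∀ K : Lvl, good K →
      ∃ (J : Type) (_ : Fintype J) (_ : DecidableEq J) (Γ : J → Level V)
        (𝒥 : ∀ j : J, Jacobian (Var.scheme (ballQuotientUniformisedDatum_of h₁) h₃ (.pms (pmsCode F ι₁ V (Γ j)))))
        (P : AbelianVariety ℂ) (π : (j : J) → (P ⟶ (𝒥 j).J)) (p : P ⟶ AK K), Nonempty (IsLimit (Fan.mk P π)) ∧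
          Surjective (AbelianVariety.Hom.toSchemeHom p)) :
    ∀ (K : Lvl) (D : Obj) (φ : Hom K D), good K → φ ≠ 0 →
      ∃ (Γ₀ : Level V) (𝒥₀ : Jacobian (Var.scheme (ballQuotientUniformisedDatum_of h₁) h₃ (.pms (pmsCode F ι₁ V Γ₀))))
        (w : 𝒥₀.J ⟶ Aμ D), w ≠ 0 := by
  intro K D φ hK hφ
  obtain ⟨J, _, _, Γ, 𝒥, P, π, p, ⟨hlim⟩, hp⟩ := hAlb K hK
  haveI := hp
  exact exists_level_hom_ne_zero_of_tmul_of_surjective h₁ h₃ Γ 𝒥 hlim p (hcar K D φ hK hφ)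

end Schema

end Model

end Summit.HodgeConjecture.CorCM

end
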